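import Summits.HubbardSuperconductivity.HubbardSuperconductivity.Theorems.ThermalWedgeTwTipContinuationEdgeOrderFreeBound
import Literature.MathematicalPhysics.QuantumLattice.HubbardOneParticleCost
import Literature.MathematicalPhysics.QuantumLattice.DWaveSourceFreeGainBound

/-!
# `TwTipContinuation` (stmt-HubbardSuperconductivity-1700) — weak-coupling darkness, piece 2:
# pair coherence is bounded by the smearing of the momentum distribution

For ANY normalised vector `ψ` of the fermionic `L × L` torus, the d-wave pair intensity
`P_L = (pairField d L)ᴴ (pairField d L) = 8 B†B`, `B = Σ_k ĝ_d(k) b_k`, `b_k = c_{-k↓} c_{k↑}`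
(`pairField_dWave_eq_smul_pairOperator`), obeys

  `re⟨ψ, P_L ψ⟩ ≤ 32 L² + 32 (Σ_k F_k)²`,   `F_k ≥ 0`,   `F_k⁴ ≤ ρ_k (1 - ρ_k)`,   `ρ_k = ⟨n_{k↑}⟩_ψ`

(`pairIntensity_le_coherence`). In words: the off-diagonal (`k ≠ k'`) pair coherence
`⟨b_k ψ, b_{k'} ψ⟩` is small at every level `k` that is nearly full OR nearly empty, because it is
bounded BOTH by `‖b_k ψ‖ ‖b_{k'} ψ‖ ≤ √(ρ_k ρ_{k'})` and — commuting the pair modes,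
`b_kᴴ b_{k'} = b_{k'} b_kᴴ` for `k ≠ k'` (`pairMode_commutator_conjTranspose`) — by
`‖b_kᴴ ψ‖ ‖b_{k'}ᴴ ψ‖ ≤ √((1-ρ_k)(1-ρ_{k'}))`; the geometric mean of the two bounds is `F_k F_{k'}`.
The diagonal contributes at most `Σ_k ĝ_k² ≤ 4L²`. Macroscopic pair coherence `re⟨P_L⟩ ≳ cL⁴`
therefore forces `Σ_k (ρ_k(1-ρ_k))^{1/4} ≳ √c L²`: a smeared Fermi surface on a positive
fraction of the Brillouin zone, which the kinetic-energy budget of a weak-coupling ground state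
cannot afford (pieces 3–4). Elementary (CAR, Cauchy–Schwarz); the two-sided Cauchy–Schwarz
trick is the one behind the Bell/Yang ODLRO bounds (Yang, Rev. Mod. Phys. 34 (1962) 694, §4). [folklore]
-/

noncomputable section

namespace Summit.HubbardSuperconductivity.TwTipContinuation.WeakCouplingDarkness

open Matrix Finset
open Literature.MathematicalPhysics.QuantumLattice Literature.Probability.LatticeModels
open Summit.HubbardSuperconductivity.TwTipContinuation.IsogapTransport
open scoped ComplexOrder ComplexConjugate

variable {L : ℕ} [NeZero L]

/-- The `ℓ²` norm of a Fock vector (local notation). -/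
local notation "‖" v "‖₂" => ‖(WithLp.toLp 2 v : EuclideanSpace ℂ (Finset (Orb (FermionTorus 2 L))))‖

/-! ### Norm bookkeeping -/

omit [NeZero L] in
/-- `‖v‖₂² = re⟨v, v⟩`. [folklore] -/
theorem normSq_eq_re (v : Fock (Orb (FermionTorus 2 L))) : ‖v‖₂ ^ 2 = (star v ⬝ᵥ v).re :=
  ThermodynamicLimit.norm_toLp_sq v

omit [NeZero L] in
/-- **Cauchy–Schwarz** for the `dotProduct` pairing: `|re⟨u, v⟩| ≤ ‖u‖₂ ‖v‖₂`. [folklore] -/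
theorem abs_re_star_dotProduct_le (u v : Fock (Orb (FermionTorus 2 L))) :
    |(star u ⬝ᵥ v).re| ≤ ‖u‖₂ * ‖v‖₂ := by
  rw [ThermodynamicLimit.star_dotProduct_eq_inner]
  exact (Complex.abs_re_le_norm _).trans (norm_inner_le_norm _ _)

/-- `‖c_{kσ} φ‖₂² = re⟨φ, n_{kσ} φ⟩ ≤ re⟨φ, φ⟩`: annihilating a mode does not increase the norm. [folklore] -/
theorem normSq_momentumAnnihilation_mulVec (k : TorusSite 2 L) (σ : Fin 2)
    (φ : Fock (Orb (FermionTorus 2 L))) :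
    ‖momentumAnnihilation k σ *ᵥ φ‖₂ ^ 2 = (expect (momentumNumber k σ) φ).re := by
  rw [normSq_eq_re, ThermodynamicLimit.star_mulVec_dotProduct, momentumAnnihilation_conjTranspose, mulVec_mulVec]
  rfl

/-- `‖c†_{kσ} φ‖₂² = re⟨φ, φ⟩ - re⟨φ, n_{kσ} φ⟩ ≤ re⟨φ, φ⟩`: creating a mode does not increase the
norm (`c c† = 1 - c† c`). [folklore] -/
theorem normSq_momentumCreation_mulVec (k : TorusSite 2 L) (σ : Fin 2)
    (φ : Fock (Orb (FermionTorus 2 L))) :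
    ‖momentumCreation k σ *ᵥ φ‖₂ ^ 2 = (star φ ⬝ᵥ φ).re - (expect (momentumNumber k σ) φ).re := by
  rw [normSq_eq_re, ThermodynamicLimit.star_mulVec_dotProduct, momentumCreation_conjTranspose, mulVec_mulVec,
    ← one_sub_momentumNumber, sub_mulVec, one_mulVec, dotProduct_sub, Complex.sub_re]
  rfl

/-- `‖b_k ψ‖₂² ≤ ρ_k = re⟨ψ, n_{k↑} ψ⟩` (`b_k = c_{-k↓} c_{k↑}`). [folklore] -/
theorem normSq_pairMode_mulVec_le (k : TorusSite 2 L) (ψ : Fock (Orb (FermionTorus 2 L))) :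
    ‖pairMode k *ᵥ ψ‖₂ ^ 2 ≤ (expect (momentumNumber k 0) ψ).re := by
  rw [pairMode, ← mulVec_mulVec, normSq_momentumAnnihilation_mulVec]
  have h := re_expect_momentumNumber_le (-k) 1 (momentumAnnihilation k 0 *ᵥ ψ)
  rwa [← normSq_eq_re, normSq_momentumAnnihilation_mulVec] at h

/-- `‖b_kᴴ ψ‖₂² ≤ 1 - ρ_k` for normalised `ψ` (`b_kᴴ = c†_{k↑} c†_{-k↓} = -c†_{-k↓} c†_{k↑}`). [folklore] -/
theorem normSq_pairMode_conjTranspose_mulVec_le (k : TorusSite 2 L)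
    {ψ : Fock (Orb (FermionTorus 2 L))} (hψ : star ψ ⬝ᵥ ψ = 1) :
    ‖(pairMode k)ᴴ *ᵥ ψ‖₂ ^ 2 ≤ 1 - (expect (momentumNumber k 0) ψ).re := by
  have hswap : (pairMode k)ᴴ *ᵥ ψ = -(momentumCreation (-k) 1 *ᵥ (momentumCreation k 0 *ᵥ ψ)) := by
    rw [pairMode_conjTranspose, momentumCreation_mul_eq_neg, neg_mulVec, mulVec_mulVec]
  rw [hswap]
  have hneg : ‖-(momentumCreation (-k) 1 *ᵥ (momentumCreation k 0 *ᵥ ψ))‖₂ =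
      ‖momentumCreation (-k) 1 *ᵥ (momentumCreation k 0 *ᵥ ψ)‖₂ := by
    rw [WithLp.toLp_neg, norm_neg]
  rw [hneg, normSq_momentumCreation_mulVec]
  have h0 := re_expect_momentumNumber_nonneg (-k) 1 (momentumCreation k 0 *ᵥ ψ)
  have h1 : (star (momentumCreation k 0 *ᵥ ψ) ⬝ᵥ (momentumCreation k 0 *ᵥ ψ)).re =
      1 - (expect (momentumNumber k 0) ψ).re := by
    rw [← normSq_eq_re, normSq_momentumCreation_mulVec, hψ, Complex.one_re]
  linarith

/-! ### The two-sided Cauchy–Schwarz bound on the pair coherence -/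

/-- For `k ≠ k'`: `⟨b_k ψ, b_{k'} ψ⟩ = ⟨b_{k'}ᴴ ψ, b_kᴴ ψ⟩` (the pair modes `b_kᴴ`, `b_{k'}` commute). [folklore] -/
theorem star_pairMode_mulVec_dotProduct_of_ne {k k' : TorusSite 2 L} (hkk' : k ≠ k')
    (ψ : Fock (Orb (FermionTorus 2 L))) :
    star (pairMode k *ᵥ ψ) ⬝ᵥ (pairMode k' *ᵥ ψ) =
      star ((pairMode k')ᴴ *ᵥ ψ) ⬝ᵥ ((pairMode k)ᴴ *ᵥ ψ) := by
  have hcomm : pairMode k' * (pairMode k)ᴴ = (pairMode k)ᴴ * pairMode k' := by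
    have h := pairMode_commutator_conjTranspose k' k
    rw [if_neg (Ne.symm hkk'), sub_eq_zero] at h
    exact h
  rw [ThermodynamicLimit.star_mulVec_dotProduct, mulVec_mulVec, ← hcomm, ← mulVec_mulVec,
    ThermodynamicLimit.star_mulVec_dotProduct, conjTranspose_conjTranspose]

omit [NeZero L] in
/-- `min(x, y) ≤ √(x y)` for `x, y ≥ 0`. [folklore] -/
theorem min_le_sqrt_mul {x y : ℝ} (hx : 0 ≤ x) (hy : 0 ≤ y) : min x y ≤ Real.sqrt (x * y) := by
  refine Real.le_sqrt_of_sq_le ?_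
  rcases le_total x y with h | h
  · rw [min_eq_left h, sq]; exact mul_le_mul_of_nonneg_left h hx
  · rw [min_eq_right h, sq]; exact mul_le_mul_of_nonneg_right h hy

omit [NeZero L] in
/-- Two upper bounds `|r| ≤ a a'` and `|r| ≤ b b'` (all factors `≥ 0`) combine to
`|r| ≤ √(a b) √(a' b')` (geometric mean). [folklore] -/
theorem abs_le_sqrt_mul_sqrt_of_two_bounds {r a a' b b' : ℝ} (ha : 0 ≤ a) (ha' : 0 ≤ a')
    (hb : 0 ≤ b) (hb' : 0 ≤ b') (h1 : |r| ≤ a * a') (h2 : |r| ≤ b * b') :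
    |r| ≤ Real.sqrt (a * b) * Real.sqrt (a' * b') := by
  have hmin : |r| ≤ min (a * a') (b * b') := le_min h1 h2
  calc |r| ≤ min (a * a') (b * b') := hmin
    _ ≤ Real.sqrt ((a * a') * (b * b')) := min_le_sqrt_mul (by positivity) (by positivity)
    _ = Real.sqrt ((a * b) * (a' * b')) := by congr 1; ring
    _ = Real.sqrt (a * b) * Real.sqrt (a' * b') := Real.sqrt_mul (by positivity) _

/-- **Two-sided Cauchy–Schwarz.** For `k ≠ k'`:
`|re⟨b_k ψ, b_{k'} ψ⟩| ≤ √(‖b_kψ‖ ‖b_kᴴψ‖) · √(‖b_{k'}ψ‖ ‖b_{k'}ᴴψ‖)`. [folklore] -/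
theorem abs_re_pairCoherence_le {k k' : TorusSite 2 L} (hkk' : k ≠ k')
    (ψ : Fock (Orb (FermionTorus 2 L))) :
    |(star (pairMode k *ᵥ ψ) ⬝ᵥ (pairMode k' *ᵥ ψ)).re| ≤
      Real.sqrt (‖pairMode k *ᵥ ψ‖₂ * ‖(pairMode k)ᴴ *ᵥ ψ‖₂) *
        Real.sqrt (‖pairMode k' *ᵥ ψ‖₂ * ‖(pairMode k')ᴴ *ᵥ ψ‖₂) := by
  have h1 := abs_re_star_dotProduct_le (pairMode k *ᵥ ψ) (pairMode k' *ᵥ ψ)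
  have h2 := abs_re_star_dotProduct_le ((pairMode k')ᴴ *ᵥ ψ) ((pairMode k)ᴴ *ᵥ ψ)
  rw [← star_pairMode_mulVec_dotProduct_of_ne hkk'] at h2
  exact abs_le_sqrt_mul_sqrt_of_two_bounds (norm_nonneg _) (norm_nonneg _) (norm_nonneg _)
    (norm_nonneg _) h1 (h2.trans_eq (mul_comm _ _))

/-! ### The coherence bound -/

/-- `P_L = 8 BᴴB` with `B = Σ_k ĝ_d(k) b_k` the d-wave pair operator. [folklore] -/
theorem pairIntensity_eq_smul :
    (pairField dWaveFormFactor L)ᴴ * pairField dWaveFormFactor L =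
      (8 : ℂ) • ((pairOperator dWaveGap (Finset.univ : Finset (TorusSite 2 L)))ᴴ *
        pairOperator dWaveGap (Finset.univ : Finset (TorusSite 2 L))) := by
  rw [pairField_dWave_eq_smul_pairOperator, conjTranspose_neg, conjTranspose_smul, neg_mul, mul_neg,
    neg_neg, smul_mul_smul_comm]
  congr 1
  rw [Complex.star_def, Complex.conj_ofReal, ← Complex.ofReal_mul]
  have : (2 * Real.sqrt 2) * (2 * Real.sqrt 2) = (8 : ℝ) := by
    have h := Real.mul_self_sqrt (show (0 : ℝ) ≤ 2 by norm_num)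
    nlinarith
  rw [this]; norm_num

/-- `B ψ = Σ_k ĝ_d(k) (b_k ψ)`. [folklore] -/
theorem pairOperator_mulVec (ψ : Fock (Orb (FermionTorus 2 L))) :
    pairOperator dWaveGap (Finset.univ : Finset (TorusSite 2 L)) *ᵥ ψ =
      ∑ k : TorusSite 2 L, ((dWaveGap k : ℝ) : ℂ) • (pairMode k *ᵥ ψ) := by
  rw [pairOperator, sum_mulVec]
  exact Finset.sum_congr rfl fun k _ => smul_mulVec _ _ _

/-- `re⟨ψ, P_L ψ⟩ = 8 Σ_{k,k'} ĝ_k ĝ_{k'} re⟨b_k ψ, b_{k'} ψ⟩`. [folklore] -/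
theorem re_expect_pairIntensity_eq (ψ : Fock (Orb (FermionTorus 2 L))) :
    (expect ((pairField dWaveFormFactor L)ᴴ * pairField dWaveFormFactor L) ψ).re =
      8 * ∑ k : TorusSite 2 L, ∑ k' : TorusSite 2 L,
        dWaveGap k * dWaveGap k' * (star (pairMode k *ᵥ ψ) ⬝ᵥ (pairMode k' *ᵥ ψ)).re := by
  rw [pairIntensity_eq_smul, expect_smul]
  unfold Literature.MathematicalPhysics.QuantumLattice.expect
  rw [← mulVec_mulVec, ← ThermodynamicLimit.star_mulVec_dotProduct, pairOperator_mulVec, star_sum, sum_dotProduct]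
  have h8 : ((8 : ℂ) * ∑ k : TorusSite 2 L, star (((dWaveGap k : ℝ) : ℂ) • (pairMode k *ᵥ ψ)) ⬝ᵥ
      ∑ k' : TorusSite 2 L, ((dWaveGap k' : ℝ) : ℂ) • (pairMode k' *ᵥ ψ)).re =
      8 * (∑ k : TorusSite 2 L, star (((dWaveGap k : ℝ) : ℂ) • (pairMode k *ᵥ ψ)) ⬝ᵥ
      ∑ k' : TorusSite 2 L, ((dWaveGap k' : ℝ) : ℂ) • (pairMode k' *ᵥ ψ)).re := by
    rw [show (8 : ℂ) = ((8 : ℝ) : ℂ) by norm_num, Complex.re_ofReal_mul]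
  rw [h8, Complex.re_sum]
  congr 1
  refine Finset.sum_congr rfl fun k _ => ?_
  rw [dotProduct_sum, Complex.re_sum]
  refine Finset.sum_congr rfl fun k' _ => ?_
  rw [star_smul, smul_dotProduct, dotProduct_smul, smul_eq_mul, smul_eq_mul, Complex.star_def,
    Complex.conj_ofReal, ← mul_assoc, ← Complex.ofReal_mul, Complex.re_ofReal_mul]

/-- For every normalised `ψ` there are `F_k ≥ 0` with `F_k⁴ ≤ ρ_k(1 - ρ_k)`,
`ρ_k = re⟨ψ, n_{k↑} ψ⟩`, such that `re⟨ψ, P_L ψ⟩ ≤ 32 L² + 32 (Σ_k F_k)²`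
(namely `F_k = √(‖b_kψ‖ ‖b_kᴴψ‖)`). [folklore] -/
theorem exists_coherenceWeights (ψ : Fock (Orb (FermionTorus 2 L))) (hψ : star ψ ⬝ᵥ ψ = 1) :
    ∃ F : TorusSite 2 L → ℝ, (∀ k, 0 ≤ F k) ∧
      (∀ k, F k ^ 4 ≤ (expect (momentumNumber k 0) ψ).re * (1 - (expect (momentumNumber k 0) ψ).re)) ∧
      (expect ((pairField dWaveFormFactor L)ᴴ * pairField dWaveFormFactor L) ψ).re ≤
        32 * (L : ℝ) ^ 2 + 32 * (∑ k, F k) ^ 2 := by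
  -- the smearing weights
  set F : TorusSite 2 L → ℝ := fun k =>
    Real.sqrt (‖pairMode k *ᵥ ψ‖₂ * ‖(pairMode k)ᴴ *ᵥ ψ‖₂) with hF
  have hF0 : ∀ k, 0 ≤ F k := fun k => Real.sqrt_nonneg _
  have hρ1 : ∀ k, (expect (momentumNumber k 0) ψ).re ≤ 1 := fun k => by
    have := re_expect_momentumNumber_le k 0 ψ
    rwa [hψ, Complex.one_re] at this
  have hF4 : ∀ k, F k ^ 4 ≤ (expect (momentumNumber k 0) ψ).re * (1 - (expect (momentumNumber k 0) ψ).re) := by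
    intro k
    have ha := normSq_pairMode_mulVec_le k ψ
    have hb := normSq_pairMode_conjTranspose_mulVec_le k hψ
    have h4 : F k ^ 4 = ‖pairMode k *ᵥ ψ‖₂ ^ 2 * ‖(pairMode k)ᴴ *ᵥ ψ‖₂ ^ 2 := by
      rw [hF]
      simp only
      rw [show (4 : ℕ) = 2 * 2 by norm_num, pow_mul, Real.sq_sqrt (by positivity)]
      ring
    rw [h4]
    exact mul_le_mul ha hb (by positivity) (re_expect_momentumNumber_nonneg k 0 ψ)
  refine ⟨F, hF0, hF4, ?_⟩
  -- termwise bound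
  have hg : ∀ k : TorusSite 2 L, |dWaveGap k| ≤ 2 := abs_dWaveGap_le_two
  have hterm : ∀ k k' : TorusSite 2 L,
      dWaveGap k * dWaveGap k' * (star (pairMode k *ᵥ ψ) ⬝ᵥ (pairMode k' *ᵥ ψ)).re ≤
        (if k = k' then 4 else 0) + 4 * (F k * F k') := by
    intro k k'
    by_cases hkk' : k = k'
    · subst hkk'
      rw [if_pos rfl]
      have hdiag : (star (pairMode k *ᵥ ψ) ⬝ᵥ (pairMode k *ᵥ ψ)).re ≤ 1 := by
        rw [← normSq_eq_re]
        exact (normSq_pairMode_mulVec_le k ψ).trans (hρ1 k)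
      have hdiag0 : 0 ≤ (star (pairMode k *ᵥ ψ) ⬝ᵥ (pairMode k *ᵥ ψ)).re := by
        rw [← normSq_eq_re]; positivity
      have hgg : dWaveGap k * dWaveGap k ≤ 4 := by
        have := hg k
        rw [abs_le] at this
        nlinarith
      have hFF : 0 ≤ F k * F k := mul_nonneg (hF0 k) (hF0 k)
      nlinarith [mul_le_mul hgg hdiag hdiag0 (by norm_num : (0 : ℝ) ≤ 4)]
    · rw [if_neg hkk', zero_add]
      have hcs := abs_re_pairCoherence_le hkk' ψ
      have hFk : Real.sqrt (‖pairMode k *ᵥ ψ‖₂ * ‖(pairMode k)ᴴ *ᵥ ψ‖₂) = F k := rfl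
      have hFk' : Real.sqrt (‖pairMode k' *ᵥ ψ‖₂ * ‖(pairMode k')ᴴ *ᵥ ψ‖₂) = F k' := rfl
      rw [hFk, hFk'] at hcs
      have hgg : |dWaveGap k * dWaveGap k'| ≤ 4 := by
        rw [abs_mul]
        have := mul_le_mul (hg k) (hg k') (abs_nonneg _) (by norm_num)
        linarith
      calc dWaveGap k * dWaveGap k' * (star (pairMode k *ᵥ ψ) ⬝ᵥ (pairMode k' *ᵥ ψ)).re
          ≤ |dWaveGap k * dWaveGap k' * (star (pairMode k *ᵥ ψ) ⬝ᵥ (pairMode k' *ᵥ ψ)).re| :=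
            le_abs_self _
        _ = |dWaveGap k * dWaveGap k'| * |(star (pairMode k *ᵥ ψ) ⬝ᵥ (pairMode k' *ᵥ ψ)).re| :=
            abs_mul _ _
        _ ≤ 4 * (F k * F k') := mul_le_mul hgg hcs (abs_nonneg _) (by norm_num)
  rw [re_expect_pairIntensity_eq]
  have hdiag : ∑ k : TorusSite 2 L, ∑ k' : TorusSite 2 L, (if k = k' then (4 : ℝ) else 0) = 4 * (L : ℝ) ^ 2 := by
    simp only [Finset.sum_ite_eq, Finset.mem_univ, if_true, Finset.sum_const, Finset.card_univ,
      card_torusSite_two, nsmul_eq_mul]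
    push_cast
    ring
  have hoff : ∑ k : TorusSite 2 L, ∑ k' : TorusSite 2 L, 4 * (F k * F k') = 4 * (∑ k, F k) ^ 2 := by
    rw [sq, Finset.sum_mul_sum, Finset.mul_sum]
    refine Finset.sum_congr rfl fun k _ => ?_
    rw [Finset.mul_sum]
  have hsum : ∑ k : TorusSite 2 L, ∑ k' : TorusSite 2 L,
      dWaveGap k * dWaveGap k' * (star (pairMode k *ᵥ ψ) ⬝ᵥ (pairMode k' *ᵥ ψ)).re ≤
      4 * (L : ℝ) ^ 2 + 4 * (∑ k, F k) ^ 2 := by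
    calc ∑ k : TorusSite 2 L, ∑ k' : TorusSite 2 L,
          dWaveGap k * dWaveGap k' * (star (pairMode k *ᵥ ψ) ⬝ᵥ (pairMode k' *ᵥ ψ)).re
        ≤ ∑ k : TorusSite 2 L, ∑ k' : TorusSite 2 L, ((if k = k' then (4 : ℝ) else 0) + 4 * (F k * F k')) :=
          Finset.sum_le_sum fun k _ => Finset.sum_le_sum fun k' _ => hterm k k'
      _ = 4 * (L : ℝ) ^ 2 + 4 * (∑ k, F k) ^ 2 := by
          rw [← hdiag, ← hoff, ← Finset.sum_add_distrib]
          exact Finset.sum_congr rfl fun k _ => Finset.sum_add_distrib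
  linarith

/-- **Pair coherence is bounded by the smearing of the momentum distribution (piece 2 of the
weak-coupling darkness bound for `TwTipContinuation`).** For every side `L ≥ 1` and every
normalised `ψ` there are `F_k ≥ 0` with `F_k⁴ ≤ ρ_k(1 - ρ_k)`, `ρ_k = re⟨ψ, n_{k↑} ψ⟩`, such that
`re⟨ψ, (pairField d L)ᴴ (pairField d L) ψ⟩ ≤ 32 L² + 32 (Σ_k F_k)²`. [folklore] -/
theorem pairIntensity_le_coherence :
    ∀ (L : ℕ) [NeZero L] (ψ : Fock (Orb (FermionTorus 2 L))), star ψ ⬝ᵥ ψ = 1 → ∃ F : TorusSite 2 L → ℝ, (∀ k, 0 ≤ F k) ∧ (∀ k, F k ^ 4 ≤ (expect (momentumNumber k 0) ψ).re * (1 - (expect (momentumNumber k 0) ψ).re)) ∧ (expect ((pairField dWaveFormFactor L)ᴴ * pairField dWaveFormFactor L) ψ).re ≤ 32 * (L : ℝ) ^ 2 + 32 * (∑ k, F k) ^ 2 :=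
  fun _ _ ψ hψ => exists_coherenceWeights ψ hψ

end Summit.HubbardSuperconductivity.TwTipContinuation.WeakCouplingDarkness
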